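import Literature.Probability.Percolation.SlabRSWGluingCore
import HarnessLib

/-!
# Newman–Tassion–Wu 2017, §3.2 — the gluing lemmas for slabs: direct gluing to a target set

Topic: `Literature/Probability/Percolation`. Second file of the port of §3 of Newman–Tassion–Wu,
*Critical percolation and the minimal spanning tree in slabs* (CPAM 70 (2017); arXiv:1512.09107).
The proof of the main gluing lemma (Thm. 3.7) performs a local surgery near a point `z` of the
minimal path `Γ = Γ_min^S(A,B)` and recovers `z` through the minimal path of the new configuration
(`SlabRSWGluingCore.lean`). That recovery needs the rerouted structure to contain no vertex of `Ā`
with a key below `Γ₀`'s — a condition the printed proof does not secure when the ball `B_{r+1}(z)`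
meets `Ā` (nor, symmetrically, when a vertex of `C̄` lies within distance `r` of `Γ̄`, where the
printed Fact 1 fails). In those two boundary situations NO minimal path is needed: the `C`-cluster
(resp. the `A`-cluster, which contains `Γ`) comes within bounded distance of the target set `Ā`
(resp. `C̄`) and is glued to it DIRECTLY, the surgery being recovered through the statistic
"vertices of the target set joined to the source set by an open path avoiding the rest of the
target set". This file is that geometry-free gadget, for an arbitrary source set `Src` and target
set `Tg` inside a domain `R`:

* `DirectGlue k R Src Tg ω` — the data: a cleared planar set `D ⊆ R` avoiding `Src`; a port vertex
  `q₁ ∉ D̄` that is `ω`-joined to a vertex of `S̄rc` inside `(R ∖ D)‾`; a self-avoiding lattice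
  chain `q₁ :: L` with `L ⊆ D̄` non-empty, ending at a vertex of `T̄g`, no other vertex of it in
  `T̄g`.
* `DirectGlue.newConfig` — close every pair touching `D̄`, open the chain.
* PROVED: `newConfig_mem` (the new configuration joins `Src` to `Tg` inside `R̄`), `last_mem_attT`
  and `attT_subset` (the statistic `attT` contains the end of the chain and lies in `D̄`), locality
  `mem_newConfig_iff_of_not_touch`.

## Sources

* C. M. Newman, V. Tassion, W. Wu, *Critical percolation and the minimal spanning tree in slabs*,
  Comm. Pure Appl. Math. 70 (2017), arXiv:1512.09107: §3.2, proof of Theorem 3.7 (the local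
  modification (1)–(3) and the recovery sentence, pp. 9–10 of the arXiv text), here in the
  degenerate geometry where the modification touches `Ā` or `C̄` [NewmanTassionWu2017].

## Design choices

* The port edge `s(q₁, L.head)` is OPENED (it need not be `ω`-open): this covers both the case
  where the source cluster enters `D̄` (then it is the entry edge) and the case where it only
  comes next to `D̄`.
* The source-side connection is recorded as `ω ∈ openConnIn ((R ∖ D)‾) s₀ q₁`; nothing else about
  the source cluster is used.
-/

noncomputable section

namespace Literature.Probability.Percolation

open MeasureTheory LatticeModels SimpleGraph Filter Topology

namespace NTW17

variable (k : ℕ)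

/-- **The statistic of a direct gluing**: the vertices `t` of `T̄g` joined inside `R̄` to a
vertex of `S̄rc` by an `ω'`-open path using no other vertex of `T̄g`. A function of `ω'` alone.
[cite: NewmanTassionWu2017, §3.2 (proof of Theorem 3.7, the recovery sentence)] -/
def attT (R Src Tg : Set (ℤ × ℤ)) (ω' : BondConfig (slab 3 k)) : Set (slab 3 k) :=
  {t | t ∈ slabLift k Tg ∧ ∃ s ∈ slabLift k Src,
    ω' ∈ openConnIn (slabLift k R ∩ {v | v ∉ slabLift k Tg ∨ v = t}) t s}

/-- **The data of a direct gluing of the source cluster to the target set** (NTW 2017, proof of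
Thm. 3.7, steps (2)–(3), in the degenerate geometry where the local modification reaches the
target set itself): a cleared planar set `D ⊆ R` off `Src`; a port vertex `q₁ ∉ D̄`, `ω`-joined
to `s₀ ∈ S̄rc` inside `(R ∖ D)‾`; a non-empty self-avoiding lattice chain `q₁ :: L` with `L ⊆ D̄`
ending in `T̄g` and otherwise off `T̄g`.
[cite: NewmanTassionWu2017, §3.2 (proof of Theorem 3.7, steps (2)–(3))] -/
structure DirectGlue (R Src Tg : Set (ℤ × ℤ)) (ω : BondConfig (slab 3 k)) where
  /-- the cleared columns -/
  D : Set (ℤ × ℤ)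
  /-- the port vertex (outside `D̄`) -/
  q₁ : slab 3 k
  /-- the source vertex -/
  s₀ : slab 3 k
  /-- the opened chain after the port vertex (inside `D̄`) -/
  L : List (slab 3 k)
  hDR : D ⊆ R
  hDSrc : ∀ z ∈ D, z ∉ Src
  hq₁D : planar k q₁ ∉ D
  hs₀ : s₀ ∈ slabLift k Src
  hσ : ω ∈ openConnIn (slabLift k (R \ D)) s₀ q₁
  hL : L ≠ []
  hLD : ∀ x ∈ L, planar k x ∈ D
  hchain : (q₁ :: L).IsChain (fun a b => (slabGraph 3 k).Adj a b)
  hnodup : (q₁ :: L).Nodup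
  hlast : L.getLast hL ∈ slabLift k Tg
  hoff : ∀ x ∈ L.dropLast, x ∉ slabLift k Tg

namespace DirectGlue

variable {k} {R Src Tg : Set (ℤ × ℤ)} {ω : BondConfig (slab 3 k)} (dg : DirectGlue k R Src Tg ω)

/-- The glued target vertex. [cite: NewmanTassionWu2017, §3.2 (proof of Theorem 3.7, steps (2)–(3))] -/
def α : slab 3 k := dg.L.getLast dg.hL

/-- The opened edges. [cite: NewmanTassionWu2017, §3.2 (proof of Theorem 3.7, step (3))] -/
def structEdges : Set (Sym2 (slab 3 k)) := edgesOf (dg.q₁ :: dg.L)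

/-- **The new configuration**: close every pair touching `D̄`, open the chain.
[cite: NewmanTassionWu2017, §3.2 (proof of Theorem 3.7, steps (2)–(3))] -/
def newConfig : BondConfig (slab 3 k) := (ω \ touch k dg.D) ∪ dg.structEdges

/-- `α ∈ T̄g`. [cite: NewmanTassionWu2017, §3.2 (proof of Theorem 3.7)] -/
theorem α_mem : dg.α ∈ slabLift k Tg := dg.hlast

/-- `α ∈ L`. [cite: NewmanTassionWu2017, §3.2 (proof of Theorem 3.7)] -/
theorem α_mem_L : dg.α ∈ dg.L := List.getLast_mem _

/-- `α ∈ D̄`. [cite: NewmanTassionWu2017, §3.2 (proof of Theorem 3.7)] -/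
theorem α_D : planar k dg.α ∈ dg.D := dg.hLD _ dg.α_mem_L

/-- The port vertex lies in `(R ∖ D)‾`. [cite: NewmanTassionWu2017, §3.2 (proof of Theorem 3.7)] -/
theorem q₁_mem : dg.q₁ ∈ slabLift k (R \ dg.D) := by
  have := dg.hσ
  rw [mem_openConnIn_iff_pathIn] at this
  exact this.right_mem

/-- The source vertex lies in `(R ∖ D)‾`. [cite: NewmanTassionWu2017, §3.2 (proof of Theorem 3.7)] -/
theorem s₀_mem : dg.s₀ ∈ slabLift k (R \ dg.D) := by
  have := dg.hσ
  rw [mem_openConnIn_iff_pathIn] at this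
  exact this.left_mem

/-- `q₁ ∉ L`. [cite: NewmanTassionWu2017, §3.2 (proof of Theorem 3.7)] -/
theorem q₁_not_mem_L : dg.q₁ ∉ dg.L := (List.nodup_cons.1 dg.hnodup).1

/-- An opened edge has an endpoint in `L`. [cite: NewmanTassionWu2017, §3.2 (proof of Theorem 3.7)] -/
theorem structEdges_L {a b : slab 3 k} (h : s(a, b) ∈ dg.structEdges) : a ∈ dg.L ∨ b ∈ dg.L := by
  obtain ⟨ha, hb⟩ := mem_of_mem_edgesOf h
  have hab : a ≠ b :=
    ((SimpleGraph.mem_edgeSet (slabGraph 3 k)).1 (edgesOf_subset_edgeSet dg.hchain h)).ne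
  rcases List.mem_cons.1 ha with rfl | ha
  · rcases List.mem_cons.1 hb with hb | hb
    · exact absurd hb.symm hab
    · exact Or.inr hb
  · exact Or.inl ha

/-- Opened edges touch `D̄`. [cite: NewmanTassionWu2017, §3.2 (proof of Theorem 3.7)] -/
theorem structEdges_touch : dg.structEdges ⊆ touch k dg.D := by
  intro e he
  induction e using Sym2.ind with
  | h a b =>
    rcases dg.structEdges_L he with h | h
    · exact mk_mem_touch_iff.2 (Or.inl (dg.hLD a h))
    · exact mk_mem_touch_iff.2 (Or.inr (dg.hLD b h))

/-- **Locality**: off the pairs touching `D̄`, the new configuration is the old one.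
[cite: NewmanTassionWu2017, §3.2 (proof of Theorem 3.7)] -/
theorem mem_newConfig_iff_of_not_touch {e : Sym2 (slab 3 k)} (he : e ∉ touch k dg.D) :
    e ∈ dg.newConfig ↔ e ∈ ω := by
  constructor
  · rintro (h | h)
    · exact h.1
    · exact absurd (dg.structEdges_touch h) he
  · exact fun h => Or.inl ⟨h, he⟩

/-- An old open edge between vertices off `D̄` stays open. [cite: NewmanTassionWu2017, §3.2 (proof of Theorem 3.7)] -/
theorem mem_newConfig_of_off {a b : slab 3 k} (hab : s(a, b) ∈ ω) (ha : planar k a ∉ dg.D)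
    (hb : planar k b ∉ dg.D) : s(a, b) ∈ dg.newConfig :=
  (dg.mem_newConfig_iff_of_not_touch (by simp [ha, hb])).2 hab

/-- The new configuration is a lattice configuration. [cite: NewmanTassionWu2017, §3.2 (proof of Theorem 3.7)] -/
theorem newConfig_lattice (hω : ω ⊆ (slabGraph 3 k).edgeSet) :
    dg.newConfig ⊆ (slabGraph 3 k).edgeSet := by
  rintro e (h | h)
  · exact hω h.1
  · exact edgesOf_subset_edgeSet dg.hchain h

/-- A new-open pair at a vertex of `D̄` is an opened edge. [cite: NewmanTassionWu2017, §3.2 (proof of Theorem 3.7)] -/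
theorem edge_at_D {q x : slab 3 k} (h : s(q, x) ∈ dg.newConfig) (hx : planar k x ∈ dg.D) :
    s(q, x) ∈ dg.structEdges := by
  rcases h with h | h
  · exact absurd (mk_mem_touch_iff.2 (Or.inr hx)) h.2
  · exact h

/-- **The only new-open edge into `D̄` from outside is the port edge.**
[cite: NewmanTassionWu2017, §3.2 (proof of Theorem 3.7)] -/
theorem eq_q₁_of_edge {u v : slab 3 k} (h : s(u, v) ∈ dg.newConfig) (hu : planar k u ∉ dg.D)
    (hv : planar k v ∈ dg.D) : u = dg.q₁ := by
  have he := dg.edge_at_D h hv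
  obtain ⟨hu', -⟩ := mem_of_mem_edgesOf he
  rcases List.mem_cons.1 hu' with h' | h'
  · exact h'
  · exact absurd (dg.hLD u h') hu

/-- **No source vertex is joined to the target set outside `D̄` in the new configuration**: an
`ω'`-open path from a vertex `t ∉ D̄` of `T̄g` that reaches `S̄rc` inside `R̄` avoiding the other
vertices of `T̄g` would either stay off the pairs touching `D̄` (then it is `ω`-open) or enter `D̄`
through the port vertex (then its initial piece joins `t` to `q₁` in `ω`); either way `t` would be
`ω`-joined inside `R̄` to `S̄rc`. [cite: NewmanTassionWu2017, §3.2 (proof of Theorem 3.7, the recovery sentence)] -/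
theorem joined_of_pathIn {t : slab 3 k} (htD : planar k t ∉ dg.D) {A : Set (slab 3 k)}
    (hA : A ⊆ slabLift k R) {s : slab 3 k} (hpath : PathIn (openGraph dg.newConfig) A t s) :
    (planar k s ∉ dg.D ∧ ω ∈ openConnIn (slabLift k R) t s) ∨
      ω ∈ openConnIn (slabLift k R) t dg.q₁ := by
  obtain ⟨ht, h⟩ := hpath
  induction h with
  | refl => exact Or.inl ⟨htD, openConnIn_refl (hA ht)⟩
  | @tail b c _ hbc ih =>
    rcases ih with ⟨hbD, hjb⟩ | hj
    · obtain ⟨hadj, hcA⟩ := hbc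
      have he : s(b, c) ∈ dg.newConfig ∧ b ≠ c := (openGraph_adj _ b c).1 hadj
      by_cases hcD : planar k c ∈ dg.D
      · -- the edge enters `D̄`: `b = q₁`
        right
        have hb : b = dg.q₁ := dg.eq_q₁_of_edge he.1 hbD hcD
        rwa [hb] at hjb
      · left
        refine ⟨hcD, SlabCriticality.openConnIn_trans hjb ?_⟩
        have hω : s(b, c) ∈ ω := (dg.mem_newConfig_iff_of_not_touch (by simp [hbD, hcD])).1 he.1
        have hbR : b ∈ slabLift k R := by
          have := hjb; rw [mem_openConnIn_iff_pathIn] at this; exact this.right_mem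
        exact openConnIn_head_of_mem b [c]
          (List.isChain_cons_cons.2 ⟨⟨hω, he.2⟩, List.isChain_singleton _⟩)
          (fun v hv => by
            simp only [List.mem_cons, List.not_mem_nil, or_false] at hv
            rcases hv with rfl | rfl
            · exact hbR
            · exact hA hcA) c (by simp)
    · exact Or.inr hj

/-- **The statistic localises the gluing**: if `Src` is not joined to `Tg` inside `R̄` in `ω`,
then `attT(ω') ⊆ D̄`. [cite: NewmanTassionWu2017, §3.2 (proof of Theorem 3.7, the recovery sentence)] -/
theorem attT_subset (hX : ω ∉ slabConn k R Src Tg) : attT k R Src Tg dg.newConfig ⊆ slabLift k dg.D := by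
  rintro t ⟨htT, s, hs, hj⟩
  by_contra htD
  rw [mem_slabLift_iff] at htD
  rw [mem_openConnIn_iff_pathIn] at hj
  rcases dg.joined_of_pathIn htD (fun x hx => hx.1) hj with ⟨-, h⟩ | h
  · exact hX ⟨s, hs, t, htT, openConnIn_reverse h⟩
  · exact hX ⟨dg.s₀, dg.hs₀, t, htT, openConnIn_reverse (SlabCriticality.openConnIn_trans h
      (openConnIn_reverse (openConnIn_mono (slabLift_mono k (fun _ h => h.1)) _ _ dg.hσ)))⟩

/-- On `{Src ⟷^R Tg}ᶜ`, no vertex `ω`-joined to `s₀` inside `R̄` lies in `T̄g`; in particular the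
port vertex does not. [cite: NewmanTassionWu2017, §3.2 (proof of Theorem 3.7)] -/
theorem not_Tg_of_joined (hX : ω ∉ slabConn k R Src Tg) {v : slab 3 k}
    (hv : ω ∈ openConnIn (slabLift k R) dg.s₀ v) : v ∉ slabLift k Tg := fun hvT =>
  hX ⟨dg.s₀, dg.hs₀, v, hvT, hv⟩

/-- The chain `q₁ :: L` reversed joins `α` to `q₁` in the new configuration, inside `R̄` and
avoiding `T̄g ∖ {α}`. [cite: NewmanTassionWu2017, §3.2 (proof of Theorem 3.7)] -/
theorem α_joined_q₁ (hX : ω ∉ slabConn k R Src Tg) :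
    dg.newConfig ∈ openConnIn (slabLift k R ∩ {v | v ∉ slabLift k Tg ∨ v = dg.α}) dg.α dg.q₁ := by
  have hch : (dg.q₁ :: dg.L).IsChain (fun a b => s(a, b) ∈ dg.newConfig ∧ a ≠ b) :=
    isChain_of_edgesOf_subset dg.hchain fun e he => Or.inr he
  have hsub : ∀ x ∈ dg.q₁ :: dg.L, x ∈ slabLift k R ∩ {v | v ∉ slabLift k Tg ∨ v = dg.α} := by
    intro x hx
    rcases List.mem_cons.1 hx with rfl | hx
    · exact ⟨slabLift_mono k (fun _ h => h.1) dg.q₁_mem, Or.inl (dg.not_Tg_of_joined hX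
        (openConnIn_mono (slabLift_mono k (fun _ h => h.1)) _ _ dg.hσ))⟩
    · refine ⟨dg.hDR (dg.hLD x hx), ?_⟩
      by_cases hxa : x = dg.α
      · exact Or.inr hxa
      · refine Or.inl (dg.hoff x ?_)
        have := List.dropLast_concat_getLast dg.hL
        rw [← this] at hx
        rcases List.mem_append.1 hx with h | h
        · exact h
        · exact absurd (List.mem_singleton.1 h) hxa
  have h := openConnIn_of_isChain _ _ hch hsub
  have hlast : (dg.q₁ :: dg.L).getLast (List.cons_ne_nil _ _) = dg.α := by
    rw [List.getLast_cons dg.hL]; rfl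
  rw [hlast] at h
  exact openConnIn_reverse h

/-- The source-side connection survives in the new configuration and avoids `T̄g`.
[cite: NewmanTassionWu2017, §3.2 (proof of Theorem 3.7)] -/
theorem q₁_joined_s₀ (hX : ω ∉ slabConn k R Src Tg) :
    dg.newConfig ∈ openConnIn (slabLift k R ∩ {v | v ∉ slabLift k Tg ∨ v = dg.α}) dg.q₁ dg.s₀ := by
  have h1 : ω ∈ openConnIn (slabLift k (R \ dg.D) ∩ {v | v ∉ slabLift k Tg ∨ v = dg.α}) dg.s₀ dg.q₁ :=
    openConnIn_inter_of_forall dg.hσ fun v _ hjv =>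
      Or.inl (dg.not_Tg_of_joined hX (openConnIn_mono (slabLift_mono k (fun _ h => h.1)) _ _ hjv))
  have h2 : dg.newConfig ∈ openConnIn
      (slabLift k (R \ dg.D) ∩ {v | v ∉ slabLift k Tg ∨ v = dg.α}) dg.s₀ dg.q₁ :=
    openConnIn_of_subset_on h1 fun a ha b hb hab => dg.mem_newConfig_of_off hab ha.1.2 hb.1.2
  refine openConnIn_reverse (openConnIn_mono (fun x hx => ?_) _ _ h2)
  exact ⟨slabLift_mono k (fun _ h => h.1) hx.1, hx.2⟩

/-- **The glued vertex is recovered**: `α ∈ attT(ω')`. [cite: NewmanTassionWu2017, §3.2 (proof of Theorem 3.7, the recovery sentence)] -/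
theorem α_mem_attT (hX : ω ∉ slabConn k R Src Tg) : dg.α ∈ attT k R Src Tg dg.newConfig :=
  ⟨dg.α_mem, dg.s₀, dg.hs₀, SlabCriticality.openConnIn_trans (dg.α_joined_q₁ hX) (dg.q₁_joined_s₀ hX)⟩

/-- The statistic of the new configuration is non-empty. [cite: NewmanTassionWu2017, §3.2 (proof of Theorem 3.7)] -/
theorem attT_nonempty (hX : ω ∉ slabConn k R Src Tg) : (attT k R Src Tg dg.newConfig).Nonempty :=
  ⟨dg.α, dg.α_mem_attT hX⟩

/-- **The new configuration joins `Src` to `Tg` inside `R̄`.** [cite: NewmanTassionWu2017, §3.2 (proof of Theorem 3.7, "By construction")] -/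
theorem newConfig_mem (hX : ω ∉ slabConn k R Src Tg) : dg.newConfig ∈ slabConn k R Src Tg := by
  obtain ⟨hαT, s, hs, hj⟩ := dg.α_mem_attT hX
  exact ⟨s, hs, dg.α, hαT, openConnIn_reverse (openConnIn_mono (fun x hx => hx.1) _ _ hj)⟩

/-- **Recovery window**: `ω` and the new configuration agree off the pairs touching `D̄`.
[cite: NewmanTassionWu2017, §3.2 (proof of Theorem 3.7)] -/
theorem agree_off_touch {e : Sym2 (slab 3 k)} (he : e ∉ touch k dg.D) : (e ∈ ω ↔ e ∈ dg.newConfig) :=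
  (dg.mem_newConfig_iff_of_not_touch he).symm

end DirectGlue

end NTW17

end Literature.Probability.Percolation
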